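import Summits.BirchSwinnertonDyer.BirchSwinnertonDyer.Theorems.QuadraticBranchSignedControlPlusEtaLowerInclusionPrimeCofactor
import Summits.BirchSwinnertonDyer.BirchSwinnertonDyer.Theorems.QuadraticBranchSignedControlPlusEtaLowerInclusionRankZeroPairs
import Summits.BirchSwinnertonDyer.BirchSwinnertonDyer.Theorems.QuadraticBranchSignedControlPlusEtaLowerInclusionRung39675m1
import HarnessLib

/-!
# Route `QuadraticBranchSignedControl` (rung K8, cell `bsd-potss`), crux `PlusEtaLowerInclusion`
# (item stmt-BirchSwinnertonDyer-19601): the rank-zero analytic sub-loci IN SELMER CURRENCY — on a tower-onto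
# pair with `L_p⁺(V,η,0) ≠ 0` and a quadratic (`λ ≤ 2`) or top-segment cofactor, (E⁺_η) needs ONE element of
# `Sel_{p^∞}(W/ℚ)`, not the lower `p`-part of BSD (seat `bsd-potss-k8eta-c1` g12; `--supports` 19601)

WHAT. The registered stub `stub_etaLower_r0_lowerBSD` asks, on the rank-zero tower-onto partners `W`, for
L₀ = `MissingLowerBoundAt W p` (`ord_p #Ш_an(W) ≤ ord_p #Ш(W)`), which the converse-control road (p468146) turns
into (E⁺_η). THIS FILE shows that on the analytic sub-loci of this seat's two squeezes the algebraic input drops to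
ONE factor of `p` in `#Sel_{p^∞}(W/ℚ)`:
* §1 `dvd_constantCoeff_etaCharGenerator_of_dvd_card_selmerGroupPInfty` — the even bottom-layer control of the
  tree (`EvenControlZero.finite_and_padicValNat_card_selmerGroupPInfty_le_of_quadraticTwist_signedPrime`,
  through the `W`-coordinate strict plus datum and the `η`-transport, exactly as in p459681's Selmer-witness road)
  read at one factor: `p ∣ #Sel_{p^∞}(W/ℚ)` and `ξ(0) ≠ 0` ⟹ `p ∣ ξ(0)` for every characteristic power series `ξ`
  of an `η`-datum;
* §2 `quadraticBranchPlusEta_pair_of_namedFacts_of_invol_of_lambda_le_two_of_dvd_card_selmer` — GRANTED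
  {Kobayashi 2.2η/4.1η, Kitajima–Otsuki 1.3η, B. D. Kim 3.11η}: `L_p⁺(V,η,0) ≠ 0 ∧ p ∤ coeff₂` + `p ∣ #Sel_{p^∞}(W)`
  ⟹ (E⁺_η) ∧ (C1⁺_η) (gen 11's factorisation-free FE squeeze at `r = 0`);
* §3 `quadraticBranchPlusEta_pair_of_namedFacts_of_topSegment_of_dvd_card_selmer` — GRANTED {Kobayashi 2.2η/4.1η,
  Kitajima–Otsuki 1.3η} only: the top-segment certificate of length `d ≥ 2` + `p ∣ #Sel_{p^∞}(W)` ⟹ (E⁺_η) ∧ (C1⁺_η)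
  (this seat's prime-cofactor squeeze at `r = 0`).
READING (numbers): on the 14 Tamagawa-free rank-zero tower-onto census rows (`ord₅ #Ш_an = 2`; 12 of them with
`λ⁺_η = 2`: 137775i1, 211600eb1, 218450n1, 291525bp1, 302050f1, 333975m1, 39675m1 (the BC5 rung), 80550g1, 444900i1,
449650br1, 141512r1, 254310t1) the per-row algebraic input of (E⁺_η) drops from «`25 ∣ #Sel_{5^∞}(W)`» (Selmer-shape
witness of p459681) to «`5 ∣ #Sel_{5^∞}(W)`», i.e. ONE non-trivial element of `Ш(W)[5]`; per row both are
delivered by the unit Kurihara numbers already recorded (Kim 2026), so NO census number moves (40/40). Class-wide,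
the rank-zero Tamagawa-free part of the crux on {`λ⁺_η ≤ 2`} ∪ {top segment} is «`p ∣ #Ш_an(W) ⟹ Ш(W)[p] ≠ 0`» —
strictly weaker than L₀ and still OPEN.

HONEST FRAMING (cell `bsd-potss`, run/shared/lean/pub/bsd-potss/; FULL-BSD rank ≤ 1 programme, HUMAN RULING
D-0036/D-0074): TOOL THEOREMS, CONDITIONAL on the named Literature facts in hypothesis position and on displayed
per-pair inputs (on `V`: tower onto, the analytic shape; on `W`: one factor of `p` in `#Sel_{p^∞}`). Crux 19601 is
OPEN class-wide and NOT closed; nothing is booked; `BSD(W, p)` is claimed for no pair. No definition, no named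
fact, no `sorry`, axioms standard.

References: [Kobayashi2003] Thm. 2.2 (p. 5), (3.6) (p. 7), §4 + Thm. 4.1 (p. 8), Thm. 9.3 (p. 26); [KitajimaOtsuki2018]
Thm. 1.3; [KimBD2008MRL] Thm. 3.11 (p. 93); [GreenbergLNM1716] §1, §4 Lemma 4.2; [Washington1997] §7.1, §13.2.
-/

set_option autoImplicit false
set_option linter.dupNamespace false

noncomputable section

open scoped Classical

open CongruenceSubgroup Field WeierstrassCurve
open Literature.NumberTheory.EllipticCurves
open Literature.NumberTheory.EllipticCurves.ModularForms
open Literature.NumberTheory.GaloisRepresentations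
open Literature.NumberTheory.EllipticCurves.IwasawaDual
open Literature.NumberTheory.EllipticCurves.IwasawaAlgebra
open Summit.BirchSwinnertonDyer.Rank1Residual.Additive
open Summit.BirchSwinnertonDyer.Rank1Residual.Additive.SignedTwist
open Summit.BirchSwinnertonDyer.Rank1Residual.AdditivePotMult

namespace Summit.BirchSwinnertonDyer.BirchSwinnertonDyer.Theorems

section Pair

variable {V : WeierstrassCurve ℚ} [V.IsElliptic] [V.IsGloballyMinimal] {p : ℕ} [hp : Fact p.Prime]

/-! ## §1 One factor of `p` in `#Sel_{p^∞}(W/ℚ)` gives one factor of `p` in `ξ(0)` -/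

/-- **`p ∣ #Sel_{p^∞}(W/ℚ)` ⟹ `p ∣ ξ(0)`** for every characteristic power series `ξ` with `ξ(0) ≠ 0` of an
`η`-datum `D` of the tower-onto twist `V = C • W^{(p*)}`: the even bottom-layer control
`ord_p #Sel_{p^∞}(W/ℚ) ≤ v_p(ξ(0))` (tree `EvenControlZero.…`, on the `W`-coordinate strict plus datum, transported
to `D` by the `η`-transport and the uniqueness of Pontryagin duals; Kitajima–Otsuki for the no-finite-submodule
input, Kobayashi 2.2η for torsion), read at one factor. GRANTED the two named facts; CONDITIONAL.
[cite: Kobayashi2003, Thm. 2.2 (p. 5), Thm. 9.3 (p. 26)] [cite: KitajimaOtsuki2018, Thm. 1.3]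
[cite: GreenbergLNM1716, §1 (p. 60), §4 Lemma 4.2 (p. 102)] -/
theorem dvd_constantCoeff_etaCharGenerator_of_dvd_card_selmerGroupPInfty
    (h22 : Kobayashi2003.thm22_etaSignedSelmerDual_finite_torsion)
    (hKO : KitajimaOtsuki2018.mainThm13_etaSignedSelmerDual_noFiniteSubmodule)
    (W : WeierstrassCurve ℚ) [W.IsElliptic] [W.IsGloballyMinimal] (C : VariableChange ℚ)
    (hCV : C • W.quadraticTwist ((-1) ^ (p / 2) * p) = V)
    (hSel : p ∣ Nat.card ↥(W.selmerGroupPInfty p))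
    {K₀ : Type} [Field K₀] [NumberField K₀] [IsCyclotomicExtension {p} ℚ K₀]
    [(galRange (K := ℚ) K₀).Normal] {ηq : absoluteGaloisGroup ℚ →* ℤˣ}
    (hηK : ∀ σ ∈ galRange (K := ℚ) K₀, ηq σ = 1) (hη1 : ηq ≠ 1)
    (hp2 : p ≠ 2) (hgood : V.HasGoodReductionAtPrime p) (hap : V.frobeniusTrace p = 0)
    {κ : ZpExtension ℚ p} {γ : absoluteGaloisGroup ℚ} (hκ : κ.IsCyclotomic)
    (hγ : κ.IsTopGenerator γ) (hγK : γ ∈ galRange (K := ℚ) K₀)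
    (D : EtaSignedSelmerDualData V κ K₀ ℚ_[p] ηq γ 1) {g : IwasawaAlgebra p}
    (hg' : D.charIdeal = Ideal.span {g}) (hg0 : PowerSeries.constantCoeff g ≠ 0) :
    (p : ℤ_[p]) ∣ PowerSeries.constantCoeff g := by
  -- a `W`-coordinate plus dual datum and its transport to an `η`-datum at `γ`
  obtain ⟨DW⟩ := nonempty_strictSignedSelmerDualData W κ ℚ_[p] 1 hγ
  obtain ⟨θ₀, hθ₀2⟩ := exists_sq_eq_pStar p K₀ hp2
  have hc₀ : θ₀ ^ 2 = algebraMap ℚ K₀ ((-1) ^ (p / 2) * p) := by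
    rw [hθ₀2, map_mul, map_pow, map_neg, map_one, map_natCast]
  have hθ₀ : θ₀ ∉ Set.range (algebraMap ℚ K₀) := by
    rintro ⟨r, hr⟩
    apply forall_sq_ne_pStar p r
    apply (algebraMap ℚ K₀).injective
    rw [map_pow, hr, hc₀]
  have hη : ∀ σ, ηq σ = 1 ↔ σ • rootInClosure K₀ θ₀ = rootInClosure K₀ θ₀ :=
    eta_eq_one_iff_smul_rootInClosure p K₀ hθ₀ hc₀ ηq hηK hη1
  have hDK := localTowerHyp_padic p κ K₀ hκ
  have hκ₀ : ∀ x, ∃ g ∈ galRange (K := ℚ) K₀, κ g = x := kappa_surjOn_galRange_cyclotomic κ K₀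
  have hcop : (galRange (K := ℚ) K₀).index.Coprime p := coprime_index_galRange_cyclotomic p K₀
  have hγγ : γ⁻¹ * γ ∈ κ.kerSubgroup := by rw [inv_mul_cancel]; exact one_mem _
  obtain ⟨D', hfin', htor', hchar', hnf'⟩ :=
    exists_etaSignedSelmerDualData_one W K₀ hθ₀ hc₀ p κ hCV ηq hη ℚ_[p] hDK hκ₀ hcop hγK hγγ DW
  obtain ⟨hfinD', htorD'⟩ :=
    EtaSignedSelmerDualData.finite_isTorsion_of_thm22 h22 hηK hp2 hgood hap hκ hγ hγK D'
  haveI : Module.Finite (IwasawaAlgebra p) DW.X := hfin'.mp hfinD'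
  have htorW : Module.IsTorsion (IwasawaAlgebra p) DW.X := htor'.mp htorD'
  have hnfW : ∀ M : Submodule (IwasawaAlgebra p) DW.X, Finite M → M = ⊥ :=
    hnf'.mp (hKO p K₀ ηq hηK V hp2 hgood hap κ γ hκ hγ hγK 1 D'.toLiterature hfinD' htorD')
  obtain ⟨e, -⟩ := isDualPair_exists_linearEquiv
    (EtaSignedSelmerDualData.isDualPair V κ K₀ ℚ_[p] ηq 1 D hκ₀ hγ hγK)
    (EtaSignedSelmerDualData.isDualPair V κ K₀ ℚ_[p] ηq 1 D' hκ₀ hγ hγK)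
  have hcharW : DW.charIdeal = Ideal.span {g} := by
    rw [← hchar', ← hg']
    exact (Module.charIdeal_eq_of_linearEquiv e).symm
  obtain ⟨hfinSel, hSelle⟩ :=
    EvenControlZero.finite_and_padicValNat_card_selmerGroupPInfty_le_of_quadraticTwist_signedPrime W κ
      hp2 C V hCV hgood hap hγ DW htorW hnfW hcharW hg0
  -- one factor: `1 ≤ ord_p #Sel ≤ v_p(g(0))`
  haveI := hfinSel
  have hcard : Nat.card ↥(W.selmerGroupPInfty p) ≠ 0 := Nat.card_pos.ne'
  have h1 : 1 ≤ padicValNat p (Nat.card ↥(W.selmerGroupPInfty p)) := one_le_padicValNat_of_dvd hcard hSel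
  have h1' : (1 : ℤ) ≤ ((PowerSeries.constantCoeff g : ℤ_[p]) : ℚ_[p]).valuation :=
    le_trans (by exact_mod_cast h1) hSelle
  rw [PadicInt.valuation_coe] at h1'
  rw [← pow_one (p : ℤ_[p])]
  exact (padicInt_pow_dvd_iff_le_valuation hg0 1).mpr (by exact_mod_cast h1')

/-! ## §2 The functional-equation squeeze at `r = 0` in Selmer currency -/

/-- **(E⁺_η) ∧ (C1⁺_η) at a tower-onto pair from `L_p⁺(V,η,0) ≠ 0 ∧ p ∤ coeff₂ L_p⁺(V,η,T)` and ONE element of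
`Sel_{p^∞}(W/ℚ)`.** GRANTED Kobayashi 2.2η / 4.1η, Kitajima–Otsuki 1.3η and B. D. Kim 3.11η (NAMED facts): for a
globally minimal partner `W` (`C • W^{(p*)} = V`, `p ≥ 5`, tower onto; good reduction and `a_p(V) = 0` are the
node's own binders) with `p ∣ #Sel_{p^∞}(W/ℚ)` and the analytic shape (`μ = 0`, `λ ≤ 2`, order `0`) displayed:
(E⁺_η)(V,p) ∧ (C1⁺_η)(V,p) — `T⁰ ∣ ξ ∣ L`, `(ι ξ) = (ξ)`, `p ∣ ξ(0)` (§1), and gen 11's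
`span_singleton_eq_of_invol_of_unitCoeff` at `r = 0`. No `V`-certificate, no `L(W,1)`, no `#Ш_an`. CONDITIONAL; closes
nothing class-wide. [cite: KimBD2008MRL, Thm. 3.11 (p. 93)] [cite: Kobayashi2003, Thm. 2.2 (p. 5), §4 and Thm. 4.1 (p. 8)]
[cite: KitajimaOtsuki2018, Thm. 1.3] [cite: Washington1997, §7.1 Thm. 7.3] -/
theorem quadraticBranchPlusEta_pair_of_namedFacts_of_invol_of_lambda_le_two_of_dvd_card_selmer
    (h22 : Kobayashi2003.thm22_etaSignedSelmerDual_finite_torsion)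
    (h41 : Kobayashi2003.thm41_plusEtaCharIdeal_dvd)
    (hKO : KitajimaOtsuki2018.mainThm13_etaSignedSelmerDual_noFiniteSubmodule)
    (hFE : Kim2008.thm311_etaSignedSelmerDual_charIdeal_map_invol)
    (W : WeierstrassCurve ℚ) [W.IsElliptic] [W.IsGloballyMinimal] (C : VariableChange ℚ)
    (hp5 : 5 ≤ p) (hCV : C • W.quadraticTwist ((-1) ^ (p / 2) * p) = V)
    (hsurj : ∀ m : ℕ, V.HasSurjectiveModNGaloisRep (p ^ m : ℕ))
    (hSel : p ∣ Nat.card ↥(W.selmerGroupPInfty p))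
    (han2 : ∀ {N : ℕ} [NeZero N] {f : CuspForm (Gamma0 N) 2}, IsNewformOf V f →
      ∀ (ϖ : ℚ), (if Even (p / 2) then (ϖ : ℝ) * V.realPeriodRat = plusPeriod f
          else (ϖ : ℝ) * V.imaginaryPeriodRat = minusPeriod f) →
      ∀ (Lη : IwasawaAlgebra p), IsQuadraticBranchPlusLFunction f p ϖ Lη →
        PowerSeries.coeff 0 Lη ≠ 0 ∧ ¬ (p : ℤ_[p]) ∣ PowerSeries.coeff 2 Lη) :
    QuadraticBranchPlusEtaLowerInclusionAt V p ∧ QuadraticBranchPlusEtaMainConjectureAt V p := by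
  have hE : QuadraticBranchPlusEtaLowerInclusionAt V p := by
    intro K₀ _ _ _ _ ηq hηK hη1 N _ f hp2 hgood' hap' hf ϖ hϖ Lη hL κ γ hκ hγ hγK hγc D
    obtain ⟨hfin, htor⟩ :=
      EtaSignedSelmerDualData.finite_isTorsion_of_thm22 h22 hηK hp2 hgood' hap' hκ hγ hγK D
    haveI : Module.Finite (IwasawaAlgebra p) D.X := hfin
    obtain ⟨g, hg⟩ := (charIdeal_isPrincipal_holds p D.X).principal
    have hg' : D.charIdeal = Ideal.span {g} := hg
    obtain ⟨-, hup⟩ := EtaSignedSelmerDualData.thm41_plus_of_facts h22 h41 hηK hη1 hp2 hgood' hap' hf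
      ϖ hϖ Lη hL hκ hγ hγK hγc D
    have hgL : g ∣ Lη := by
      have h := hup hsurj
      rw [hg', Ideal.span_singleton_le_span_singleton] at h
      exact h
    obtain ⟨hL0, hL2⟩ := han2 hf ϖ hϖ Lη hL
    have hg0 : PowerSeries.constantCoeff g ≠ 0 := by
      obtain ⟨h, hh⟩ := hgL
      intro h0
      apply hL0
      rw [← PowerSeries.coeff_zero_eq_constantCoeff_apply] at h0
      rw [hh, PowerSeries.coeff_zero_eq_constantCoeff_apply, map_mul,
        ← PowerSeries.coeff_zero_eq_constantCoeff_apply, h0, zero_mul]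
    have hcoef : (p : ℤ_[p]) ∣ PowerSeries.coeff 0 g := by
      rw [PowerSeries.coeff_zero_eq_constantCoeff_apply]
      exact dvd_constantCoeff_etaCharGenerator_of_dvd_card_selmerGroupPInfty h22 hKO W C hCV hSel hηK hη1 hp2
        hgood' hap' hκ hγ hγK D hg' hg0
    have hι : Ideal.map (invol p) (Ideal.span {g}) = Ideal.span {g} := by
      have h := hFE p K₀ ηq hηK V (by omega) hgood' hap' κ γ hκ hγ hγK 1 D.toLiterature
      rw [EtaSignedSelmerDualData.charIdeal_toLiterature, hg'] at h
      exact h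
    have hXg : (PowerSeries.X : IwasawaAlgebra p) ^ 0 ∣ g := by rw [pow_zero]; exact one_dvd _
    have heq : Ideal.span {g} = Ideal.span {Lη} :=
      span_singleton_eq_of_invol_of_unitCoeff p hp2 hXg hgL hι hcoef hL0 hL2
    rw [← heq, ← hg']
  exact ⟨hE, quadraticBranchPlusEtaMainConjectureAt_of_facts_of_surjective_of_etaLowerInclusion h22 h41 hsurj hE⟩

/-! ## §3 The prime-cofactor squeeze at `r = 0` in Selmer currency (no functional equation) -/

/-- **(E⁺_η) ∧ (C1⁺_η) at a tower-onto pair from a TOP-SEGMENT cofactor of `L_p⁺(V,η,T)` at order `0` and ONE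
element of `Sel_{p^∞}(W/ℚ)`.** GRANTED Kobayashi 2.2η / 4.1η and Kitajima–Otsuki 1.3η (NAMED facts; NO
functional equation): for a globally minimal partner `W` (`C • W^{(p*)} = V`, `p ≥ 5`, good, `a_p(V) = 0`, tower
onto; any odd `p`) with `p ∣ #Sel_{p^∞}(W/ℚ)` and the analytic top-segment certificate of length `d ≥ 2` at order `0`
(`p^{d−1} ∥ coeff₀`, `p^{d−i} ∣ coeff_i`, `p ∤ coeff_d`): (E⁺_η)(V,p) ∧ (C1⁺_η)(V,p) — `L_p⁺(V,η,T)` itself is PRIME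
(`PrimeCofactor.prime_of_topSegment_coeff`) and `p ∣ ξ(0)` (§1). CONDITIONAL; closes nothing class-wide.
[cite: Kobayashi2003, Thm. 2.2 (p. 5), §4 and Thm. 4.1 (p. 8)] [cite: KitajimaOtsuki2018, Thm. 1.3]
[cite: Washington1997, §7.1 Thm. 7.3 and §13.2] -/
theorem quadraticBranchPlusEta_pair_of_namedFacts_of_topSegment_of_dvd_card_selmer
    (h22 : Kobayashi2003.thm22_etaSignedSelmerDual_finite_torsion)
    (h41 : Kobayashi2003.thm41_plusEtaCharIdeal_dvd)
    (hKO : KitajimaOtsuki2018.mainThm13_etaSignedSelmerDual_noFiniteSubmodule)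
    (W : WeierstrassCurve ℚ) [W.IsElliptic] [W.IsGloballyMinimal] (C : VariableChange ℚ)
    (hCV : C • W.quadraticTwist ((-1) ^ (p / 2) * p) = V)
    (hsurj : ∀ m : ℕ, V.HasSurjectiveModNGaloisRep (p ^ m : ℕ))
    (hSel : p ∣ Nat.card ↥(W.selmerGroupPInfty p)) (d : ℕ) (hd2 : 2 ≤ d)
    (hanNP : ∀ {N : ℕ} [NeZero N] {f : CuspForm (Gamma0 N) 2}, IsNewformOf V f →
      ∀ (ϖ : ℚ), (if Even (p / 2) then (ϖ : ℝ) * V.realPeriodRat = plusPeriod f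
          else (ϖ : ℝ) * V.imaginaryPeriodRat = minusPeriod f) →
      ∀ (Lη : IwasawaAlgebra p), IsQuadraticBranchPlusLFunction f p ϖ Lη →
        (p : ℤ_[p]) ^ (d - 1) ∣ PowerSeries.coeff 0 Lη ∧ ¬ (p : ℤ_[p]) ^ d ∣ PowerSeries.coeff 0 Lη ∧
        (∀ i, 0 < i → i < d → (p : ℤ_[p]) ^ (d - i) ∣ PowerSeries.coeff i Lη) ∧
        ¬ (p : ℤ_[p]) ∣ PowerSeries.coeff d Lη) :
    QuadraticBranchPlusEtaLowerInclusionAt V p ∧ QuadraticBranchPlusEtaMainConjectureAt V p := by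
  have hE : QuadraticBranchPlusEtaLowerInclusionAt V p := by
    intro K₀ _ _ _ _ ηq hηK hη1 N _ f hp2 hgood' hap' hf ϖ hϖ Lη hL κ γ hκ hγ hγK hγc D
    obtain ⟨hfin, htor⟩ :=
      EtaSignedSelmerDualData.finite_isTorsion_of_thm22 h22 hηK hp2 hgood' hap' hκ hγ hγK D
    haveI : Module.Finite (IwasawaAlgebra p) D.X := hfin
    obtain ⟨g, hg⟩ := (charIdeal_isPrincipal_holds p D.X).principal
    have hg' : D.charIdeal = Ideal.span {g} := hg
    obtain ⟨-, hup⟩ := EtaSignedSelmerDualData.thm41_plus_of_facts h22 h41 hηK hη1 hp2 hgood' hap' hf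
      ϖ hϖ Lη hL hκ hγ hγK hγc D
    have hgL : g ∣ Lη := by
      have h := hup hsurj
      rw [hg', Ideal.span_singleton_le_span_singleton] at h
      exact h
    obtain ⟨hL0d, hL0', hLi, hLd⟩ := hanNP hf ϖ hϖ Lη hL
    have hL0 : PowerSeries.coeff 0 Lη ≠ 0 := fun h0 => hL0' (by rw [h0]; exact dvd_zero _)
    have hg0 : PowerSeries.constantCoeff g ≠ 0 := by
      obtain ⟨h, hh⟩ := hgL
      intro h0
      apply hL0
      rw [← PowerSeries.coeff_zero_eq_constantCoeff_apply] at h0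
      rw [hh, PowerSeries.coeff_zero_eq_constantCoeff_apply, map_mul,
        ← PowerSeries.coeff_zero_eq_constantCoeff_apply, h0, zero_mul]
    have hcoef : (p : ℤ_[p]) ∣ PowerSeries.coeff 0 g := by
      rw [PowerSeries.coeff_zero_eq_constantCoeff_apply]
      exact dvd_constantCoeff_etaCharGenerator_of_dvd_card_selmerGroupPInfty h22 hKO W C hCV hSel hηK hη1 hp2
        hgood' hap' hκ hγ hγK D hg' hg0
    have hprime : Prime Lη := PrimeCofactor.prime_of_topSegment_coeff p hd2 hLd hLi hL0d hL0'
    have hXg : (PowerSeries.X : IwasawaAlgebra p) ^ 0 ∣ g := by rw [pow_zero]; exact one_dvd _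
    have hLM : Lη = (PowerSeries.X : IwasawaAlgebra p) ^ 0 * Lη := by rw [pow_zero, one_mul]
    have heq : Ideal.span {g} = Ideal.span {Lη} :=
      PrimeCofactor.span_singleton_eq_of_prime_cofactor p hXg hgL hLM hprime hcoef
    rw [← heq, ← hg']
  exact ⟨hE, quadraticBranchPlusEtaMainConjectureAt_of_facts_of_surjective_of_etaLowerInclusion h22 h41 hsurj hE⟩

end Pair

section Rung

/-! ## §4 The BC5 rung `39675m1` in Selmer currency -/

/-- **The BC5 rung (`W₀ = 39675m1`, `p = 5`) from ONE element of `Ш(W₀)[5]`.** GRANTED Kobayashi 2.2η / 4.1η,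
Kitajima–Otsuki 1.3η and B. D. Kim 3.11η: if `5 ∣ #Sel_{5^∞}(W₀/ℚ)` (DISPLAYED — one non-trivial element; the
registered rung's by-name closer p461640 asks for the Selmer-SHAPE witness `v₅(L(W₀,1)/Ω) ≤ ord₅ #Sel`, i.e.
`25 ∣ #Sel`, plus modularity and `L(W₀,1) ≠ 0`), then for every globally minimal tower-onto good twist `V` of `W₀` by
`5` with `a_5(V) = 0` carrying the analytic shape `L_5⁺(V,η,0) ≠ 0 ∧ 5 ∤ coeff₂ L_5⁺(V,η,T)` (kit j304242: `λ⁺ = 2`,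
`μ⁺ = 0`, cofactor IRREDUCIBLE quadratic; PARI `[[2,2],[0,0]]`): (E⁺_η)(V, 5) ∧ (C1⁺_η)(V, 5). A per-row instance;
nothing booked; `BSD(W₀,5)` not claimed. [cite: KimBD2008MRL, Thm. 3.11 (p. 93)]
[cite: Kobayashi2003, §4 Even main conjecture and Thm. 4.1 (p. 8)] [cite: KitajimaOtsuki2018, Thm. 1.3]
[cite: Cremona1997, Table 1 (label 39675m1)] -/
theorem rung_39675m1_of_namedFacts_of_invol_of_dvd_card_selmer
    (h22 : Kobayashi2003.thm22_etaSignedSelmerDual_finite_torsion)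
    (h41 : Kobayashi2003.thm41_plusEtaCharIdeal_dvd)
    (hKO : KitajimaOtsuki2018.mainThm13_etaSignedSelmerDual_noFiniteSubmodule)
    (hFE : Kim2008.thm311_etaSignedSelmerDual_charIdeal_map_invol)
    (hSel : 5 ∣ Nat.card ↥((⟨0, -1, 1, -506958, -159508807⟩ : WeierstrassCurve ℚ).selmerGroupPInfty 5))
    (V : WeierstrassCurve ℚ) [V.IsElliptic] [V.IsGloballyMinimal] [Fact (5 : ℕ).Prime]
    (C : VariableChange ℚ) (hCV : C • (⟨0, -1, 1, -506958, -159508807⟩ : WeierstrassCurve ℚ).quadraticTwist 5 = V)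
    (hsurj : ∀ m : ℕ, V.HasSurjectiveModNGaloisRep (5 ^ m : ℕ))
    (han2 : ∀ {N : ℕ} [NeZero N] {f : CuspForm (Gamma0 N) 2}, IsNewformOf V f →
      ∀ (ϖ : ℚ), (if Even (5 / 2) then (ϖ : ℝ) * V.realPeriodRat = plusPeriod f
          else (ϖ : ℝ) * V.imaginaryPeriodRat = minusPeriod f) →
      ∀ (Lη : IwasawaAlgebra 5), IsQuadraticBranchPlusLFunction f 5 ϖ Lη →
        PowerSeries.coeff 0 Lη ≠ 0 ∧ ¬ ((5 : ℕ) : ℤ_[5]) ∣ PowerSeries.coeff 2 Lη) :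
    QuadraticBranchPlusEtaLowerInclusionAt V 5 ∧ QuadraticBranchPlusEtaMainConjectureAt V 5 := by
  haveI := isElliptic_39675m1
  haveI := isGloballyMinimal_39675m1
  have hD : ((-1 : ℚ) ^ ((5 : ℕ) / 2) * ((5 : ℕ) : ℚ)) = 5 := by norm_num
  exact quadraticBranchPlusEta_pair_of_namedFacts_of_invol_of_lambda_le_two_of_dvd_card_selmer h22 h41 hKO hFE
    _ C (le_refl 5) (by rw [hD]; exact hCV) hsurj hSel (fun hf => han2 hf)

end Rung

end Summit.BirchSwinnertonDyer.BirchSwinnertonDyer.Theorems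

end
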